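import Summits.QuantumFields.YangMills.Theorems.UnitScaleTiltFluctuationComparisonRegPrCertL3Tree
import Summits.QuantumFields.YangMills.Theorems.UnitScaleTiltFluctuationComparisonRegPrLiftFaceCertRestrict
import Summits.QuantumFields.YangMills.Theorems.UnitScaleTiltFluctuationComparisonRegPrLiftFaceAssembly

/-!
# Route `UnitScaleTilt` — crux `FluctuationComparisonRegPrL` (stmt-QuantumFields-19935; formerly 19201), stub `stub_oneStepSmallLift`, piece (L2),
# layer F8c: THE `L = 3` CLAUSE — the tree-coordinate certificate `CertL3Tree` (p480953) fed to `exists_approxSmallLift_of_kernel` (p478011)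
# (support file `--supports stmt-QuantumFields-19935`)

Cell `ym3-torus` (HUMAN RULING D-0037, YM ladder rung R3), seat `ym3-torus-p1` gen 11 (the «F8c» glue of fleet seat ★ym-ust-19201-p1 g2's
HANDOFF.md.g2, all inputs landed by that seat).  For every family of block size `3` and every run `K` the four kernel hypotheses of
`exists_approxSmallLift_of_kernel 3 2 kzR` are the five kernel-checked rational facts of `CertL3Tree` cast to `ℝ`:
`faceQ ↦ FaceSupported`, `sneutralQ ↦ SNeutral`, `massQ ↦ RowMass (149/288)`, `rowsQ` + `chainMassQ` ↦ `RowBound λ β` through `rowBound_of_cert`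
(`λ = 3874825/7077888`, `β = 12819/131072`), plus `keyedMassQ_restrict` (the ℚ twin of `keyedMass_restrict`); `3λ² < 1` gives `λ√3 < 1`.

* **`certL3_clause`**: `∃ κ₀ C δ₀, 0 ≤ κ₀ ∧ κ₀·√3 < 1 ∧ 0 ≤ C ∧ 0 < δ₀ ∧ ∀ F, F.L = 3 → ApproxSmallLift F κ₀ C δ₀` — the `L = 3` input of
  `oneStepSmallLift_stub_of_perL` (`…LiftLegsSlice`).

Bookkeeping only; nothing of Bałaban's is asserted.
-/

noncomputable section

open scoped BigOperators

namespace Summit.QuantumFields.YangMills.Theorems.ApproxLift.CertL3Tree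

open Summit.QuantumFields.YangMills.Theorems.ApproxLift
open Literature.MathematicalPhysics.QuantumFieldTheory.Balaban1983to89
open Literature.MathematicalPhysics.QuantumFieldTheory.Balaban1983to89.T3ContinuumYM3Torus

variable {P : Params}

/-! ## §1 The rational restriction lemma -/

/-- ℚ twin of `keyedMass_restrict`: the fibrewise mass of `(c, key)` equals that of its restriction to the support of `c`. -/
theorem keyedMassQ_restrict {ι : Type*} [Fintype ι] (c : ι → ℚ) (key : ι → Key P.d) [DecidablePred fun i => c i ≠ 0] :
    keyedMassQ (P := P) c key = keyedMassQ (P := P) (fun i : {i // c i ≠ 0} => c i.1) (fun i => key i.1) := by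
  classical
  unfold keyedMassQ
  have hFG : ∀ k : Key P.d, ∑ i ∈ Finset.univ.filter (fun i => key i = k), c i =
      ∑ j ∈ (Finset.univ : Finset {i // c i ≠ 0}).filter (fun j => key j.1 = k), c j.1 := by
    intro k
    rw [Finset.sum_filter, Finset.sum_filter]
    rw [← Finset.sum_subtype (s := Finset.univ.filter fun i => c i ≠ 0) (p := fun i => c i ≠ 0)
      (fun i => by simp) (f := fun i => if key i = k then c i else 0)]
    rw [Finset.sum_filter]
    refine Finset.sum_congr rfl fun i _ => ?_
    by_cases h1 : key i = k <;> by_cases h2 : c i ≠ 0 <;> simp [h1, h2]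
    · exact not_not.mp h2
  have hsub : (Finset.univ : Finset {i // c i ≠ 0}).image (fun j => key j.1) ⊆ Finset.univ.image key := by
    intro k hk
    obtain ⟨j, _, rfl⟩ := Finset.mem_image.mp hk
    exact Finset.mem_image_of_mem key (Finset.mem_univ _)
  rw [← Finset.sum_subset hsub]
  · exact Finset.sum_congr rfl fun k _ => by rw [hFG k]
  · intro k _ hk
    rw [hFG k, abs_eq_zero]
    refine Finset.sum_eq_zero fun j hj => ?_
    exfalso
    exact hk (Finset.mem_image.mpr ⟨j, Finset.mem_univ _, (Finset.mem_filter.mp hj).2⟩)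

/-! ## §2 The four hypotheses at the runs of a family of block size `3` -/

section Family

variable (hL : Odd 3 ∧ 1 < 3) (m : ℕ) (hm : 1 ≤ m)

/-- FACE SUPPORT at every run. -/
theorem faceSupported_F3 (K : ℕ) : FaceSupported (P := (⟨3, hL, m, hm⟩ : T3Family).P K) 2 (kzR (⟨3, hL, m, hm⟩ : T3Family)) := by
  intro a p o k hp
  show ((kzQ 3 a p o k : ℚ) : ℝ) = 0
  rw [faceQ a p o k hp, Rat.cast_zero]

/-- S-NEUTRALITY at every run. -/
theorem sNeutral_F3 (K : ℕ) : SNeutral (P := (⟨3, hL, m, hm⟩ : T3Family).P K) 2 (kzR (⟨3, hL, m, hm⟩ : T3Family)) := by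
  intro a o k
  show ∑ r : Fin 3 → Fin 3, ((kzQ 3 a (Function.update r a (⟨3 - 1, by decide⟩ : Fin 3)) o k : ℚ) : ℝ) = 0
  rw [← Rat.cast_sum, sneutralQ a o k, Rat.cast_zero]

/-- ROW MASS `149/288` at every run. -/
theorem rowMass_F3 (K : ℕ) : RowMass (P := (⟨3, hL, m, hm⟩ : T3Family).P K) 2 (kzR (⟨3, hL, m, hm⟩ : T3Family)) (149 / 288) := by
  intro a p
  show ∑ o : Orient 3, ∑ k : Fin 3 → Fin (2 * 2 + 1), |((kzQ 3 a p o k : ℚ) : ℝ)| ≤ 149 / 288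
  have h := massQ a p
  have hc : ((∑ o : Orient 3, ∑ k : Fin 3 → Fin (2 * 2 + 1), |kzQ 3 a p o k| : ℚ) : ℝ) ≤ ((149 / 288 : ℚ) : ℝ) := by exact_mod_cast h
  push_cast at hc
  exact hc

/-- ROW BOUND `(λ, β)` AT THE CERTIFICATE'S OWN PARAMETERS `P3` (`d = L = 3`), through `rowBound_of_cert` — every input is stated at `P3`. -/
theorem rowBound_P3 :
    RowBound (P := P3) (Fin 2) 2 (fun a p o k => ((kzQ 3 a p o k : ℚ) : ℝ)) (3874825 / 7077888) (12819 / 131072) := by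
  refine rowBound_of_cert (P := P3) nonempty_tri_three 2 (fun a p o k => ((kzQ 3 a p o k : ℚ) : ℝ)) _ _
    (fun μ ν h pp τ q => ((eQ 3 μ ν h pp τ q : ℚ) : ℝ)) ?_ ?_
  · intro μ ν hμν pp
    rw [rowCoef_cast (P := P3) 2 (kzQ 3) μ ν pp, chainCoef_cast (P := P3) 2 (eQ 3 μ ν hμν pp), sum_elim_cast, keyedMass_cast,
      keyedMassQ_restrict]
    have hc := (Rat.cast_le (K := ℝ)).mpr (rowsQ μ ν hμν pp)
    push_cast at hc
    exact hc
  · intro μ ν hμν pp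
    have h := chainMassQ μ ν hμν pp
    have hc : ((∑ τ : Tri 3, ∑ q : Fin 3 → Fin (2 * (2 + 1) + 1), |eQ 3 μ ν hμν pp τ q| : ℚ) : ℝ) ≤ ((12819 / 131072 : ℚ) : ℝ) := by
      exact_mod_cast h
    push_cast at hc
    exact hc

/-- ROW BOUND at every run of the family: the schema `RowBound` reads `P` only through `P.d = 3`, `P.L = 3`, so the `P3` statement IS the
run's statement (definitional transport, applied pointwise). -/
theorem rowBound_F3 (K : ℕ) :
    RowBound (P := (⟨3, hL, m, hm⟩ : T3Family).P K) (Fin 2) 2 (kzR (⟨3, hL, m, hm⟩ : T3Family)) (3874825 / 7077888) (12819 / 131072) :=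
  fun μ ν hμν pp w Bw Bd hw hd => rowBound_P3 μ ν hμν pp w Bw Bd hw hd

end Family

/-! ## §3 The `L = 3` clause -/

/-- `λ·√3 < 1` for `λ = 3874825/7077888`. -/
theorem lam_mul_sqrt_three_lt_one : (3874825 / 7077888 : ℝ) * Real.sqrt ((3 : ℕ) : ℝ) < 1 := by
  have hs : Real.sqrt ((3 : ℕ) : ℝ) < 7077888 / 3874825 := by
    rw [Real.sqrt_lt' (by norm_num)]
    norm_num
  linarith

/-- **THE `L = 3` CLAUSE OF `stub_oneStepSmallLift`**: `∃ κ₀ C δ₀, 0 ≤ κ₀ ∧ κ₀·√3 < 1 ∧ 0 ≤ C ∧ 0 < δ₀ ∧ ∀ F, F.L = 3 → ApproxSmallLift F κ₀ C δ₀`. -/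
theorem certL3_clause :
    ∃ κ₀ C δ₀ : ℝ, 0 ≤ κ₀ ∧ κ₀ * Real.sqrt ((3 : ℕ) : ℝ) < 1 ∧ 0 ≤ C ∧ 0 < δ₀ ∧
      ∀ F : T3Family, F.L = 3 → ApproxSmallLift F κ₀ C δ₀ := by
  refine exists_approxSmallLift_of_kernel 3 2 (fun F => kzR F) (K₁ := 149 / 288) (lam := 3874825 / 7077888) (β := 12819 / 131072)
    (Cq₀ := Cq P3 2 (3874825 / 7077888) (12819 / 131072) (149 / 288)) (by norm_num) (by norm_num) (by norm_num)
    lam_mul_sqrt_three_lt_one (Cq_nonneg P3 2 (by norm_num) (by norm_num) (by norm_num)) fun F hFL => ?_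
  obtain ⟨L, hL, m, hm⟩ := F
  simp only at hFL
  subst hFL
  exact ⟨le_of_eq rfl, fun K => ⟨faceSupported_F3 hL m hm K, sNeutral_F3 hL m hm K, rowMass_F3 hL m hm K, rowBound_F3 hL m hm K⟩⟩

end Summit.QuantumFields.YangMills.Theorems.ApproxLift.CertL3Tree

end
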